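import Literature.AlgebraicGeometry.Motives.MonomialSupportedHypersurfaceFamily
import Literature.AlgebraicGeometry.Motives.UniversalHypersurfaceTorusAction
import Literature.AlgebraicGeometry.HodgeTheory.DiagonalSymmetry
import HarnessLib

/-!
# The relative diagonal automorphism of the monomial-supported hypersurface family

Family `hodge`, layer `Literature/AlgebraicGeometry/Motives`. Part of the definition request
`defn-MonomialSupportedHypersurfaceFamily` (crux K1-B `stub_signPencilOrbitData` of route
SignSymmetricPowers): the RELATIVE AUTOMORPHISM `sigmaM γ : 𝒴_M ⟶ 𝒴_M` over the base `S_M` of the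
`M`-supported family (`Motives/MonomialSupportedHypersurfaceFamily`), for a diagonal `γ` fixing every
monomial of `M`, its fibre maps, and their identification with the diagonal automorphisms
`HodgeTheory.diagonalAut` of the model hypersurfaces.

Notation: `R = k[a_m | |m| = d]` the coefficient ring of the universal form `F`, `S^d = Spec R`,
`U ⊆ S^d` the locus of nonsingular forms, `𝒴 = V₊(F) ⊆ ℙⁿ⁺¹_R`, `π : 𝒴_U → U` the universal family;
`R_M = k[a_m | m ∈ M]`, `𝔸^M = Spec R_M ↪ S^d` (killing `a_m`, `m ∉ M`), `S_M = 𝔸^M ∩ U`,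
`𝒴_M = 𝒴_U ×_U S_M → S_M` the `M`-supported family (`familyM`); `σ̃_γ : 𝒴 → 𝒴` the action of the
diagonal `γ` on the universal hypersurface (`torusTotal`, file `Motives/UniversalHypersurfaceTorusAction`:
`[z] ↦ [γ • z]` on `ℙⁿ⁺¹`, `a_m ↦ γ^{-m} a_m` on coefficients).

## Construction

If `γ^m = 1` for all `m ∈ M` (`FixesMonomials`), the coefficient action `Spec β_γ` fixes `𝔸^M ↪ S^d`
pointwise (`specKill_comp_specCoeffScale`), so `(y, b) ↦ σ̃_γ(y)` on `𝒴_M` still lies over `b`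
(`torusTotalMAux_comp_totalToSpec`), lands in `𝒴_U` (`torusTotalMLift`), and
`σ_γ := ((y, b) ↦ (σ̃_γ y, b))` is a morphism `𝒴_M → 𝒴_M` over `S_M` by the universal property of the
fibre product (`sigmaMHom`, packaged over `k` as `sigmaM`). No invariance of the discriminant is used.

## What is proved

* `sigmaM_comp_familyM`: `σ_γ ≫ π_M = π_M` (automorphism over the base; its inverse is `σ_{γ⁻¹}`, not
  needed here).
* `sigmaM_comp_toProjectiveSpace`: **equivariance** — `σ_γ` followed by `𝒴_M → 𝒴_U → ℙⁿ⁺¹_k` is that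
  projection followed by `[z] ↦ [γ • z]` (`diagProjMap`).
* `exists_fiberIso_comp_hypersurfaceι`, `exists_fiberIsoM_comp_hypersurfaceι`: the fibre of `π`
  (resp. `π_M`) over a `k`-point is isomorphic to the hypersurface `X_{F_t} ⊂ ℙⁿ⁺¹_k` of its form
  **compatibly with the embeddings into `ℙⁿ⁺¹_k`** (refining the tree's
  `nonempty_fiberOver_iso_hypersurface`, which forgets the compatibility).
* `sigmaMFiber`: the fibre maps `σ_{γ,t} : 𝒴_{M,t} → 𝒴_{M,t}`, `sigmaMFiber_comp_fiberι`; and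
  `sigmaMFiber_comp_eq`: under ANY fibre isomorphism compatible with the embeddings, `σ_{γ,t}` is the
  restriction to `X_G` of `[z] ↦ [γ • z]` — over `ℂ`, `sigmaMFiber_comp_eq_diagonalAut`: it is
  `HodgeTheory.diagonalAut G` (`γ` lies in the diagonal stabiliser of every `M`-supported form,
  `mem_diagonalStabilizer_of_isSupportedOn` / `aeval_diagSubstK_of_isSupportedOn`).

The cohomological consequences over `ℂ` (conjugation of `σ_{γ,t}^*` to `diagonalAut^*`, commutation
with monodromy) are in `HodgeTheory/MonomialSupportedHypersurfaceMonodromy`.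

## References

* N. M. Katz, *Another look at the Dwork family*, in: Algebra, Arithmetic, and Geometry, Progr. Math. 269
  (2009), §3: the diagonal group acts as automorphisms of the family `X/𝔸¹` over its parameter space and
  fibrewise as the diagonal automorphisms of the members. [Katz2009]
* R. Hartshorne, *Algebraic Geometry* (1977), II Thm 3.3 (fibre products), II Example 7.1.1
  (automorphisms of `ℙⁿ` from linear substitutions), II Ex. 3.11 (a) / II Example 3.2.6 (closed
  subschemes with the same support and reduced structure coincide). [Hartshorne1977]
* C. Voisin, *Hodge Theory and Complex Algebraic Geometry II* (2003), §6.2.1 (the universal family of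
  hypersurfaces and its fibres). [VoisinHodgeII2003]
-/

noncomputable section

open CategoryTheory AlgebraicGeometry MvPolynomial Limits HomogeneousLocalization

universe u

namespace Literature.AlgebraicGeometry.Motives.UniversalHypersurface


/-! ### The relative diagonal automorphism of the `M`-supported family -/

section SigmaM

variable (k : Type u) [Field k] (n d : ℕ) (M : Set (DegIndex n d))

/-- The predicate "the diagonal `γ` **fixes the monomials of `M`**": `γ^m = 1` for every `m ∈ M`
(a hypothesis on `(M, γ)`, not a statement). [cite: Katz2009, §3] -/
def FixesMonomials (γ : Fin (n + 2) → kˣ) : Prop := ∀ m : DegIndex n d, m ∈ M → unitWeight k n γ m.1 = 1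

variable {k n d M} {γ : Fin (n + 2) → kˣ}

/-- If `γ` fixes the monomials of `M`, the coefficient scaling `β_γ` is the identity on `R_M`:
`killHom ∘ β_γ = killHom`. [cite: Katz2009, §3] -/
theorem killHom_comp_coeffScale (hγ : FixesMonomials k n d M γ) :
    (killHom k n d M).comp (coeffScale k n d γ) = killHom k n d M := by
  refine MvPolynomial.algHom_ext fun m => ?_
  rw [AlgHom.comp_apply, coeffScale_X, map_mul, ← MvPolynomial.algebraMap_eq, AlgHom.commutes]
  by_cases hm : m ∈ M
  · rw [hγ m hm, inv_one, Units.val_one, map_one, one_mul]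
  · rw [killHom_X_of_not_mem k n d M hm, mul_zero]

/-- Hence `Spec β_γ` fixes the subspace `𝔸^M ↪ S^d` pointwise: `(𝔸^M ↪ S^d) ≫ Spec β_γ = (𝔸^M ↪ S^d)`.
[cite: Katz2009, §3] -/
@[reassoc]
theorem specKill_comp_specCoeffScale (hγ : FixesMonomials k n d M γ) :
    specKill k n d M ≫ specCoeffScale k n d γ = specKill k n d M := by
  rw [← Spec.map_comp, ← CommRingCat.ofHom_comp]
  congr 2
  exact congrArg AlgHom.toRingHom (killHom_comp_coeffScale hγ)

variable (k n d M γ)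

/-- `S_M ⟶ U` on underlying schemes, with its syntactic type an arrow of open subschemes (equal to
`(toBase k n d M).left` by `rfl`). [cite: Hartshorne1977, II Ex. 2.2] -/
abbrev toBaseHom : (baseMOpens k n d M : Scheme.{u}) ⟶ (baseOpens k n d : Scheme.{u}) :=
  specKill k n d M ∣_ baseOpens k n d

/-- The inclusion `𝒴_U ⊆ 𝒴`. [cite: Hartshorne1977, II Ex. 2.2] -/
abbrev totalUι : (((totalToSpec k n d) ⁻¹ᵁ (baseOpens k n d) : (totalSpace k n d).Opens) : Scheme.{u}) ⟶
    totalSpace k n d :=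
  ((totalToSpec k n d) ⁻¹ᵁ (baseOpens k n d)).ι

/-- First projection `𝒴_M = 𝒴_U ×_U S_M → 𝒴_U` (`= (totalMToTotal k n d M).left` by `rfl`).
[cite: Hartshorne1977, II Thm 3.3] -/
abbrev prTotal : pullback (familyHom k n d) (toBaseHom k n d M) ⟶
    (((totalToSpec k n d) ⁻¹ᵁ (baseOpens k n d) : (totalSpace k n d).Opens) : Scheme.{u}) :=
  pullback.fst _ _

/-- Second projection `𝒴_M → S_M` (`= (familyM k n d M).left` by `rfl`). [cite: Hartshorne1977, II Thm 3.3] -/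
abbrev prBase : pullback (familyHom k n d) (toBaseHom k n d M) ⟶ (baseMOpens k n d M : Scheme.{u}) :=
  pullback.snd _ _

/-- The map `𝒴_M → 𝒴`, `(y, b) ↦ σ̃_γ(y)`. [cite: Katz2009, §3] -/
abbrev torusTotalMAux : pullback (familyHom k n d) (toBaseHom k n d M) ⟶ totalSpace k n d :=
  prTotal k n d M ≫ totalUι k n d ≫ torusTotal k n d γ

/-- `𝒴_U ⊆ 𝒴 → S^d` is `π ≫ (U ⊆ S^d)`. [cite: Hartshorne1977, II Ex. 2.2] -/
theorem totalUι_comp_totalToSpec :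
    totalUι k n d ≫ totalToSpec k n d = familyHom k n d ≫ (baseOpens k n d).ι :=
  (morphismRestrict_ι (totalToSpec k n d) (baseOpens k n d)).symm

/-- `(y, b) ↦ σ̃_γ(y)` followed by `𝒴 → S^d` is `(y, b) ↦ b ∈ S_M ⊆ 𝔸^M ↪ S^d` when `γ` fixes the
monomials of `M` (`σ̃_γ` covers `Spec β_γ`, which fixes `𝔸^M` pointwise). [cite: Katz2009, §3] -/
theorem torusTotalMAux_comp_totalToSpec (hγ : FixesMonomials k n d M γ) :
    torusTotalMAux k n d M γ ≫ totalToSpec k n d =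
      prBase k n d M ≫ (baseMOpens k n d M).ι ≫ specKill k n d M := by
  rw [Category.assoc, Category.assoc, torusTotal_comp_totalToSpec,
    ← Category.assoc (totalUι k n d) (totalToSpec k n d) (specCoeffScale k n d γ),
    totalUι_comp_totalToSpec, Category.assoc, pullback.condition_assoc, morphismRestrict_ι_assoc,
    specKill_comp_specCoeffScale hγ]

/-- `(y, b) ↦ σ̃_γ(y)` lands in `𝒴_U`. [cite: Katz2009, §3] -/
theorem range_torusTotalMAux_subset (hγ : FixesMonomials k n d M γ) :
    Set.range (torusTotalMAux k n d M γ) ⊆ Set.range (totalUι k n d) := by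
  rintro _ ⟨x, rfl⟩
  rw [Scheme.Opens.range_ι]
  show totalToSpec k n d (torusTotalMAux k n d M γ x) ∈ baseOpens k n d
  rw [← Scheme.Hom.comp_apply, torusTotalMAux_comp_totalToSpec k n d M γ hγ, Scheme.Hom.comp_apply,
    Scheme.Hom.comp_apply]
  have hz : (baseMOpens k n d M).ι (prBase k n d M x) ∈ (baseMOpens k n d M : Set _) := by
    rw [← Scheme.Opens.range_ι]
    exact ⟨_, rfl⟩
  exact hz

/-- The lift `𝒴_M → 𝒴_U` of `(y, b) ↦ σ̃_γ(y)` through the open immersion `𝒴_U ⊆ 𝒴`. [cite: Katz2009, §3] -/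
def torusTotalMLift (hγ : FixesMonomials k n d M γ) :
    pullback (familyHom k n d) (toBaseHom k n d M) ⟶
      (((totalToSpec k n d) ⁻¹ᵁ (baseOpens k n d) : (totalSpace k n d).Opens) : Scheme.{u}) :=
  IsOpenImmersion.lift (totalUι k n d) (torusTotalMAux k n d M γ) (range_torusTotalMAux_subset k n d M γ hγ)

/-- The lift composed with `𝒴_U ⊆ 𝒴` is `(y, b) ↦ σ̃_γ(y)`. [cite: Katz2009, §3] -/
@[reassoc]
theorem torusTotalMLift_comp_ι (hγ : FixesMonomials k n d M γ) :
    torusTotalMLift k n d M γ hγ ≫ totalUι k n d = torusTotalMAux k n d M γ :=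
  IsOpenImmersion.lift_fac _ _ _

/-- The lift is compatible with the projections to `U`: `(y, b) ↦ π(σ̃ y) = (S_M ⟶ U)(b)`. [cite: Katz2009, §3] -/
theorem torusTotalMLift_comp_familyHom (hγ : FixesMonomials k n d M γ) :
    torusTotalMLift k n d M γ hγ ≫ familyHom k n d = prBase k n d M ≫ toBaseHom k n d M := by
  rw [← cancel_mono (baseOpens k n d).ι]
  calc (torusTotalMLift k n d M γ hγ ≫ familyHom k n d) ≫ (baseOpens k n d).ι
      = torusTotalMLift k n d M γ hγ ≫ (totalUι k n d ≫ totalToSpec k n d) := by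
        rw [Category.assoc, totalUι_comp_totalToSpec]
    _ = torusTotalMAux k n d M γ ≫ totalToSpec k n d := by
        rw [← Category.assoc, torusTotalMLift_comp_ι]
    _ = prBase k n d M ≫ (baseMOpens k n d M).ι ≫ specKill k n d M :=
        torusTotalMAux_comp_totalToSpec k n d M γ hγ
    _ = (prBase k n d M ≫ toBaseHom k n d M) ≫ (baseOpens k n d).ι := by
        rw [Category.assoc, morphismRestrict_ι]

/-- **The relative diagonal automorphism on underlying schemes**: `(y, b) ↦ (σ̃_γ y, b)` on
`𝒴_M = 𝒴_U ×_U S_M`. [cite: Katz2009, §3] -/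
def sigmaMHom (hγ : FixesMonomials k n d M γ) :
    pullback (familyHom k n d) (toBaseHom k n d M) ⟶ pullback (familyHom k n d) (toBaseHom k n d M) :=
  pullback.lift (torusTotalMLift k n d M γ hγ) (prBase k n d M) (torusTotalMLift_comp_familyHom k n d M γ hγ)

/-- First component of `(y, b) ↦ (σ̃_γ y, b)`. [cite: Hartshorne1977, II Thm 3.3] -/
@[reassoc]
theorem sigmaMHom_comp_prTotal (hγ : FixesMonomials k n d M γ) :
    sigmaMHom k n d M γ hγ ≫ prTotal k n d M = torusTotalMLift k n d M γ hγ :=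
  pullback.lift_fst _ _ _

/-- Second component of `(y, b) ↦ (σ̃_γ y, b)`: `σ_γ` is over `S_M`. [cite: Hartshorne1977, II Thm 3.3] -/
@[reassoc]
theorem sigmaMHom_comp_prBase (hγ : FixesMonomials k n d M γ) :
    sigmaMHom k n d M γ hγ ≫ prBase k n d M = prBase k n d M :=
  pullback.lift_snd _ _ _

/-- **Equivariance of the projection to `ℙⁿ⁺¹_k`** (scheme level): `(y, b) ↦ (σ̃ y, b)` followed by
`𝒴_M → 𝒴_U → 𝒴 → ℙ_R → ℙ_k` is that projection followed by the diagonal transformation `[z] ↦ [γ • z]`.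
[cite: Katz2009, §3] -/
theorem sigmaMHom_comp_toProjSp (hγ : FixesMonomials k n d M γ) :
    sigmaMHom k n d M γ hγ ≫ prTotal k n d M ≫ totalUι k n d ≫ totalι k n d ≫
        HodgeTheory.UniversalHypersurface.projSpToProjSp k n d =
      prTotal k n d M ≫ (totalUι k n d ≫ totalι k n d ≫
        HodgeTheory.UniversalHypersurface.projSpToProjSp k n d) ≫ (diagProjMap k n γ).left := by
  rw [sigmaMHom_comp_prTotal_assoc, ← Category.assoc, torusTotalMLift_comp_ι, Category.assoc,
    Category.assoc, torusTotal_comp_totalι_assoc, torusProj_comp_projSpToProjSp, Category.assoc,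
    Category.assoc]
  rfl

/-! #### Packaging over `k` -/

/-- **The relative diagonal automorphism `σ_γ : 𝒴_M ⟶ 𝒴_M` of the `M`-supported family** over `k`,
for a diagonal `γ` fixing the monomials of `M`: `(y, b) ↦ (σ̃_γ y, b)`. [cite: Katz2009, §3] -/
def sigmaM (hγ : FixesMonomials k n d M γ) : totalM k n d M ⟶ totalM k n d M :=
  Over.homMk (sigmaMHom k n d M γ hγ) (by
    show sigmaMHom k n d M γ hγ ≫ prTotal k n d M ≫ familyHom k n d ≫ (baseOpens k n d).ι ≫
        specCoeffToSpec k n d =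
      prTotal k n d M ≫ familyHom k n d ≫ (baseOpens k n d).ι ≫ specCoeffToSpec k n d
    rw [sigmaMHom_comp_prTotal_assoc, ← Category.assoc, torusTotalMLift_comp_familyHom,
      pullback.condition_assoc, Category.assoc])

/-- The underlying morphism of `sigmaM` (`rfl`). [cite: Katz2009, §3] -/
theorem sigmaM_left (hγ : FixesMonomials k n d M γ) : (sigmaM k n d M γ hγ).left = sigmaMHom k n d M γ hγ :=
  rfl

/-- **`σ_γ` is an automorphism OVER the base**: `σ_γ ≫ π_M = π_M`. [cite: Katz2009, §3] -/
@[reassoc]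
theorem sigmaM_comp_familyM (hγ : FixesMonomials k n d M γ) :
    sigmaM k n d M γ hγ ≫ familyM k n d M = familyM k n d M := by
  ext : 1
  exact sigmaMHom_comp_prBase k n d M γ hγ

/-- **Equivariance**: `σ_γ` followed by the projection `𝒴_M → ℙⁿ⁺¹_k` is the projection followed by the
diagonal transformation `[z] ↦ [γ • z]` of `ℙⁿ⁺¹_k`. [cite: Katz2009, §3] -/
theorem sigmaM_comp_toProjectiveSpace (hγ : FixesMonomials k n d M γ) :
    sigmaM k n d M γ hγ ≫ totalMToTotal k n d M ≫ HodgeTheory.UniversalHypersurface.toProjectiveSpace k n d =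
      totalMToTotal k n d M ≫ HodgeTheory.UniversalHypersurface.toProjectiveSpace k n d ≫ diagProjMap k n γ := by
  ext : 1
  exact sigmaMHom_comp_toProjSp k n d M γ hγ

end SigmaM

/-! ### Fibres: the embedding into `ℙⁿ⁺¹_k`, the fibre isomorphism compatible with it, and the fibre maps of `σ_γ` -/

section Fibre

variable (k : Type u) [Field k] (n d : ℕ)

-- `Proj k[x]` / `Proj R[x]` need the grading by degree as an instance; Mathlib keeps
-- `MvPolynomial.gradedAlgebra` a def (as in every `Proj`-based file of the tree, e.g.
-- `Motives/UniversalHypersurfaceFamily`), whence the local instance attribute.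
attribute [local instance] MvPolynomial.gradedAlgebra

/-- `ℙ_k → ℙ_R → ℙ_k` along a `k`-point `s` of `U` is the identity: the composite `k → R → k` of the
structure map and the coefficient homomorphism of `s` is the identity (`pointHom_comp_algebraMap`), and
`Proj` is functorial (Mathlib `Proj.map_comp`, `Proj.map_id`). [cite: Hartshorne1977, II Ex. 2.14] -/
theorem projMapPoint_comp_projSpToProjSp (s : AlgPoints (base k n d) k) :
    projMapPoint k n d s ≫ HodgeTheory.UniversalHypersurface.projSpToProjSp k n d = 𝟙 _ := by
  letI : Algebra (CoeffRing k n d) k := (pointHom k n d s).hom.toAlgebra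
  have hcomp : (algebraMap (CoeffRing k n d) k).comp (algebraMap k (CoeffRing k n d)) = RingHom.id k := by
    change (pointHom k n d s).hom.comp (algebraMap k (CoeffRing k n d)) = _
    rw [pointHom_comp_algebraMap]
    rfl
  have key : (ProjBaseChangeRing.mapGraded (CoeffRing k n d) k (Fin (n + 2))).comp
      (ProjBaseChangeRing.mapGraded k (CoeffRing k n d) (Fin (n + 2))) =
        GradedRingHom.id (MvPolynomial.homogeneousSubmodule (Fin (n + 2)) k) := by
    refine DFunLike.ext _ _ fun p => ?_
    change MvPolynomial.map (algebraMap (CoeffRing k n d) k)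
      (MvPolynomial.map (algebraMap k (CoeffRing k n d)) p) = p
    rw [MvPolynomial.map_map, hcomp, MvPolynomial.map_id]
  have hmap : ∀ (f g : MvPolynomial.homogeneousSubmodule (Fin (n + 2)) k →+*ᵍ
      MvPolynomial.homogeneousSubmodule (Fin (n + 2)) k) (hf hg), f = g → Proj.map f hf = Proj.map g hg := by
    rintro f g hf hg rfl
    rfl
  calc projMapPoint k n d s ≫ HodgeTheory.UniversalHypersurface.projSpToProjSp k n d
      = Proj.map ((ProjBaseChangeRing.mapGraded (CoeffRing k n d) k (Fin (n + 2))).comp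
          (ProjBaseChangeRing.mapGraded k (CoeffRing k n d) (Fin (n + 2)))) _ :=
        (Proj.map_comp _ _ (ProjBaseChangeRing.irrelevant_le_map k (CoeffRing k n d) (Fin (n + 2)))
          (ProjBaseChangeRing.irrelevant_le_map (CoeffRing k n d) k (Fin (n + 2)))).symm
    _ = Proj.map (GradedRingHom.id (MvPolynomial.homogeneousSubmodule (Fin (n + 2)) k)) (by simp) :=
        hmap _ _ _ _ key
    _ = 𝟙 _ := Proj.map_id

/-- **The embedding of the fibre `𝒴_s` into `ℙⁿ⁺¹_k` through the total space**: the tree's `fiberEmb s`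
(`𝒴_s ↪ ℙⁿ⁺¹_k`, a closed immersion with image `V₊(F_s)`, `Motives/UniversalHypersurfaceFibre`) is
`𝒴_s → 𝒴_U → 𝒴 → ℙ_R → ℙ_k`. [cite: VoisinHodgeII2003, §6.2.1] -/
theorem fst_comp_totalι_comp_projSpToProjSp (s : AlgPoints (base k n d) k) :
    (pullback.fst (family k n d).left s.left ≫ ((totalToSpec k n d) ⁻¹ᵁ (baseOpens k n d)).ι ≫
        totalι k n d) ≫ HodgeTheory.UniversalHypersurface.projSpToProjSp k n d = fiberEmb k n d s := by
  rw [← fiberEmb_comp_projMapPoint, Category.assoc, projMapPoint_comp_projSpToProjSp, Category.comp_id]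

/-- **The fibre of the universal family over `s ∈ U(k)` is `X_{F_s}`, compatibly with the embeddings into
`ℙⁿ⁺¹_k`** (`d ≥ 1`): an isomorphism `e : 𝒴_s ≅ X_{F_s}` over `k` with `e ≫ (X_{F_s} ↪ ℙⁿ⁺¹) = (𝒴_s → 𝒴_U → ℙⁿ⁺¹)`
(both are reduced closed subschemes of `ℙⁿ⁺¹_k` with support `V₊(F_s)`; refines
`nonempty_fiberOver_iso_hypersurface`, which forgets the compatibility). [cite: VoisinHodgeII2003, §6.2.1] -/
theorem exists_fiberIso_comp_hypersurfaceι (hd : 0 < d) (s : AlgPoints (base k n d) k) :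
    ∃ e : fiberOver (family k n d) s ≅ SmoothHypersurface.hypersurface (pointForm k n d s),
      e.hom ≫ SmoothHypersurface.hypersurfaceι (pointForm k n d s) =
        fiberι (family k n d) s ≫ HodgeTheory.UniversalHypersurface.toProjectiveSpace k n d := by
  haveI := isReduced_fiber k n d s hd
  haveI := SmoothHypersurface.isReduced_hypersurface (pointForm k n d s)
    (isHomogeneous_pointForm k n d s) (isNonsingularForm_pointForm k n d s) hd
  let ι' : (SmoothHypersurface.hypersurface (pointForm k n d s)).left ⟶ projSp n k :=
    (SmoothHypersurface.hypersurfaceι (pointForm k n d s)).left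
  haveI : IsClosedImmersion ι' := SmoothHypersurface.isClosedImmersion_hypersurfaceι_left _
  obtain ⟨e, he⟩ := exists_iso_of_isClosedImmersion_of_range_eq ι' (fiberEmb k n d s)
    ((SmoothHypersurface.range_hypersurfaceι _).trans (range_fiberEmb k n d s).symm)
  have h2 : e.hom ≫ (SmoothHypersurface.hypersurface (pointForm k n d s)).hom =
      pullback.snd (family k n d).left s.left := by
    rw [← fiberEmb_comp_projSpToSpec k n d s, ← he, Category.assoc]
    rfl
  have h3 : (specOver k k).hom = 𝟙 _ := by
    change Spec.map (CommRingCat.ofHom (RingHom.id k)) = _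
    exact Spec.map_id _
  have h4 : (fiberOver (family k n d) s).hom = pullback.snd (family k n d).left s.left := by
    rw [fiberOver_hom, h3]
    exact Category.comp_id _
  refine ⟨Over.isoMk e (h2.trans h4.symm), Over.OverMorphism.ext ?_⟩
  calc (((Over.isoMk e (h2.trans h4.symm)).hom ≫ SmoothHypersurface.hypersurfaceι (pointForm k n d s)).left)
      = e.hom ≫ ι' := rfl
    _ = fiberEmb k n d s := he
    _ = (pullback.fst (family k n d).left s.left ≫ ((totalToSpec k n d) ⁻¹ᵁ (baseOpens k n d)).ι ≫
          totalι k n d) ≫ HodgeTheory.UniversalHypersurface.projSpToProjSp k n d :=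
        (fst_comp_totalι_comp_projSpToProjSp k n d s).symm
    _ = pullback.fst (family k n d).left s.left ≫ (((totalToSpec k n d) ⁻¹ᵁ (baseOpens k n d)).ι ≫
          totalι k n d) ≫ HodgeTheory.UniversalHypersurface.projSpToProjSp k n d := Category.assoc _ _ _
    _ = pullback.fst (family k n d).left s.left ≫ ((totalToSpec k n d) ⁻¹ᵁ (baseOpens k n d)).ι ≫
          totalι k n d ≫ HodgeTheory.UniversalHypersurface.projSpToProjSp k n d :=
        whisker_eq _ (Category.assoc _ _ _)
    _ = (fiberι (family k n d) s ≫ HodgeTheory.UniversalHypersurface.toProjectiveSpace k n d).left := rfl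

variable (M : Set (DegIndex n d))

/-- **The projection of a fibre of the `M`-supported family to `ℙⁿ⁺¹_k`**: `𝒴_{M,t} → 𝒴_M → 𝒴_U → ℙⁿ⁺¹_k`.
[cite: VoisinHodgeII2003, §6.2.1] -/
abbrev fiberToProjectiveSpace (t : AlgPoints (baseM k n d M) k) :
    fiberOver (familyM k n d M) t ⟶ Motives.projectiveSpace (n + 1) k :=
  fiberι (familyM k n d M) t ≫ totalMToTotal k n d M ≫ HodgeTheory.UniversalHypersurface.toProjectiveSpace k n d

/-- **The fibre of the `M`-supported family over `t ∈ S_M(k)` is the hypersurface `X_{F_t}` of its form,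
compatibly with the embeddings into `ℙⁿ⁺¹_k`** (`d ≥ 1`): there is `e : 𝒴_{M,t} ≅ X_{F_t}` over `k` with
`e ≫ (X_{F_t} ↪ ℙⁿ⁺¹_k) = (𝒴_{M,t} → 𝒴_M → 𝒴_U → ℙⁿ⁺¹_k)`. [cite: VoisinHodgeII2003, §6.2.1] -/
theorem exists_fiberIsoM_comp_hypersurfaceι (hd : 0 < d) (t : AlgPoints (baseM k n d M) k) :
    ∃ e : fiberOver (familyM k n d M) t ≅ SmoothHypersurface.hypersurface (pointFormM k n d M t),
      e.hom ≫ SmoothHypersurface.hypersurfaceι (pointFormM k n d M t) = fiberToProjectiveSpace k n d M t := by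
  obtain ⟨e, he⟩ := exists_fiberIso_comp_hypersurfaceι k n d hd (AlgPoints.map (toBase k n d M) t)
  refine ⟨fiberOverFamilyPullbackIso (family k n d) (toBase k n d M) t ≪≫ e, ?_⟩
  calc (fiberOverFamilyPullbackIso (family k n d) (toBase k n d M) t ≪≫ e).hom ≫
        SmoothHypersurface.hypersurfaceι (pointFormM k n d M t)
      = (fiberOverFamilyPullbackIso (family k n d) (toBase k n d M) t).hom ≫ e.hom ≫
          SmoothHypersurface.hypersurfaceι (pointForm k n d (AlgPoints.map (toBase k n d M) t)) :=
        Category.assoc _ _ _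
    _ = (fiberOverFamilyPullbackIso (family k n d) (toBase k n d M) t).hom ≫
          fiberι (family k n d) (AlgPoints.map (toBase k n d M) t) ≫
            HodgeTheory.UniversalHypersurface.toProjectiveSpace k n d := by rw [he]
    _ = ((fiberOverFamilyPullbackIso (family k n d) (toBase k n d M) t).hom ≫
          fiberι (family k n d) (AlgPoints.map (toBase k n d M) t)) ≫
            HodgeTheory.UniversalHypersurface.toProjectiveSpace k n d := (Category.assoc _ _ _).symm
    _ = (fiberι (familyPullback.snd (family k n d) (toBase k n d M)) t ≫
          familyPullback.fst (family k n d) (toBase k n d M)) ≫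
            HodgeTheory.UniversalHypersurface.toProjectiveSpace k n d := by
        rw [fiberOverFamilyPullbackIso_hom_fiberι]
    _ = fiberToProjectiveSpace k n d M t := Category.assoc _ _ _

variable (γ : Fin (n + 2) → kˣ)

/-- Compatibility condition for the fibre maps of `σ_γ` (`σ_γ` is over the base). [folklore] -/
private theorem sigmaMFiber_cond (hγ : FixesMonomials k n d M γ) (t : AlgPoints (baseM k n d M) k) :
    (pullback.fst (familyM k n d M).left t.left ≫ (sigmaM k n d M γ hγ).left) ≫ (familyM k n d M).left =
      pullback.snd (familyM k n d M).left t.left ≫ t.left := by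
  rw [Category.assoc, ← Over.comp_left, sigmaM_comp_familyM, pullback.condition]

/-- **The fibre maps of `σ_γ`**: `σ_{γ,t} : 𝒴_{M,t} ⟶ 𝒴_{M,t}` with `σ_{γ,t} ≫ ι_t = ι_t ≫ σ_γ` (universal
property of the fibre product; `σ_γ` is over the base). [cite: Katz2009, §3] -/
def sigmaMFiber (hγ : FixesMonomials k n d M γ) (t : AlgPoints (baseM k n d M) k) :
    fiberOver (familyM k n d M) t ⟶ fiberOver (familyM k n d M) t :=
  Over.homMk
    (pullback.lift (pullback.fst (familyM k n d M).left t.left ≫ (sigmaM k n d M γ hγ).left)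
      (pullback.snd (familyM k n d M).left t.left) (sigmaMFiber_cond k n d M γ hγ t))
    (by
      change pullback.lift _ _ (sigmaMFiber_cond k n d M γ hγ t) ≫ pullback.fst (familyM k n d M).left t.left ≫
          (totalM k n d M).hom =
        pullback.fst (familyM k n d M).left t.left ≫ (totalM k n d M).hom
      rw [pullback.lift_fst_assoc, Category.assoc, Over.w (sigmaM k n d M γ hγ)])

/-- `σ_{γ,t} ≫ ι_t = ι_t ≫ σ_γ`. [cite: Katz2009, §3] -/
@[reassoc]
theorem sigmaMFiber_comp_fiberι (hγ : FixesMonomials k n d M γ) (t : AlgPoints (baseM k n d M) k) :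
    sigmaMFiber k n d M γ hγ t ≫ fiberι (familyM k n d M) t = fiberι (familyM k n d M) t ≫ sigmaM k n d M γ hγ := by
  ext : 1
  exact pullback.lift_fst _ _ _

/-- **On a fibre identified with a hypersurface `X_G ⊂ ℙⁿ⁺¹_k` compatibly with the embeddings, `σ_{γ,t}` is
the restriction of the diagonal transformation `[z] ↦ [γ • z]`**: for any `e : 𝒴_{M,t} ≅ X_G` with
`e ≫ (X_G ↪ ℙⁿ⁺¹) = (𝒴_{M,t} → ℙⁿ⁺¹)` and any `τ : X_G ⟶ X_G` with `τ ≫ (X_G ↪ ℙⁿ⁺¹) = (X_G ↪ ℙⁿ⁺¹) ≫ [γ•·]`,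
`σ_{γ,t} ≫ e = e ≫ τ`. [cite: Katz2009, §3] -/
theorem sigmaMFiber_comp_eq (hγ : FixesMonomials k n d M γ) (t : AlgPoints (baseM k n d M) k)
    {G : MvPolynomial (Fin (n + 2)) k} (e : fiberOver (familyM k n d M) t ≅ SmoothHypersurface.hypersurface G)
    (he : e.hom ≫ SmoothHypersurface.hypersurfaceι G = fiberToProjectiveSpace k n d M t)
    (τ : SmoothHypersurface.hypersurface G ⟶ SmoothHypersurface.hypersurface G)
    (hτ : τ ≫ SmoothHypersurface.hypersurfaceι G = SmoothHypersurface.hypersurfaceι G ≫ diagProjMap k n γ) :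
    sigmaMFiber k n d M γ hγ t ≫ e.hom = e.hom ≫ τ := by
  have h1 : (sigmaMFiber k n d M γ hγ t ≫ e.hom) ≫ SmoothHypersurface.hypersurfaceι G =
      (e.hom ≫ τ) ≫ SmoothHypersurface.hypersurfaceι G := by
    rw [Category.assoc, he, fiberToProjectiveSpace, sigmaMFiber_comp_fiberι_assoc,
      sigmaM_comp_toProjectiveSpace, Category.assoc, hτ, reassoc_of% he]
  haveI : IsClosedImmersion (SmoothHypersurface.hypersurfaceι G).left :=
    SmoothHypersurface.isClosedImmersion_hypersurfaceι_left _
  refine Over.OverMorphism.ext ((cancel_mono (SmoothHypersurface.hypersurfaceι G).left).mp ?_)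
  have h2 := congrArg Over.Hom.left h1
  simpa only [Over.comp_left, Category.assoc] using h2

end Fibre

section Stabilizer

variable (k : Type u) [Field k] (n d : ℕ) (M : Set (DegIndex n d)) (γ : Fin (n + 2) → kˣ)

/-- `∏ᵢ (γᵢ xᵢ)^{sᵢ} = γ^s · x^s` in `k[x]`. [cite: Katz2009, §3] -/
theorem prod_diagSubstK_pow (s : Fin (n + 2) →₀ ℕ) :
    (s.prod fun i e => diagSubstK k n γ i ^ e) = C ((unitWeight k n γ s : kˣ) : k) * monomial s 1 := by
  simp only [diagSubstK, mul_pow, Finsupp.prod_mul]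
  rw [unitWeight_coe, ← prod_X_pow_eq_monomial]
  congr 1
  rw [map_finsuppProd]
  simp only [map_pow]

/-- `σ_γ (c x^s) = (γ^s c) x^s`. [cite: Katz2009, §3] -/
theorem aeval_diagSubstK_monomial (s : Fin (n + 2) →₀ ℕ) (c : k) :
    aeval (diagSubstK k n γ) (monomial s c) = monomial s (((unitWeight k n γ s : kˣ) : k) * c) := by
  rw [aeval_monomial, prod_diagSubstK_pow, MvPolynomial.algebraMap_eq, ← mul_assoc, ← C_mul,
    C_mul_monomial, mul_one, mul_comm]

variable {k n d M γ}

/-- **An `M`-supported form of degree `d` is invariant under a diagonal `γ` fixing the monomials of `M`**: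
`G(γ • x) = G(x)`. [cite: Katz2009, §3] -/
theorem aeval_diagSubstK_of_isSupportedOn (hγ : FixesMonomials k n d M γ) {G : MvPolynomial (Fin (n + 2)) k}
    (hG : G.IsHomogeneous d) (hM : IsSupportedOn n d M G) : aeval (diagSubstK k n γ) G = G := by
  conv_lhs => rw [← sum_monomial_coeff_eq n d G hG]
  conv_rhs => rw [← sum_monomial_coeff_eq n d G hG]
  rw [map_sum]
  refine Finset.sum_congr rfl fun m _ => ?_
  rw [aeval_diagSubstK_monomial]
  by_cases hm : m ∈ M
  · rw [hγ m hm, Units.val_one, one_mul]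
  · rw [hM m hm, mul_zero]

end Stabilizer

section Complex

open Literature.AlgebraicGeometry.HodgeTheory

variable (n d : ℕ) (M : Set (DegIndex n d)) (γ : Fin (n + 2) → ℂˣ)

/-- Over `ℂ` the diagonal transformation of this file is the tree's `HodgeTheory.diagonalProjMap` (`rfl`).
[cite: Hartshorne1977, II Example 7.1.1] -/
theorem diagProjMap_eq_diagonalProjMap : diagProjMap ℂ n γ = HodgeTheory.diagonalProjMap γ := rfl

variable {n d M γ}

/-- A diagonal `γ` fixing the monomials of `M` lies in the diagonal stabiliser of every `M`-supported
form of degree `d`. [cite: Katz2009, §3] -/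
theorem mem_diagonalStabilizer_of_isSupportedOn (hγ : FixesMonomials ℂ n d M γ)
    {G : MvPolynomial (Fin (n + 2)) ℂ} (hG : G.IsHomogeneous d) (hM : IsSupportedOn n d M G) :
    γ ∈ HodgeTheory.diagonalStabilizer G :=
  aeval_diagSubstK_of_isSupportedOn hγ hG hM

variable (n d M γ)

/-- **Under a fibre isomorphism compatible with the embeddings, `σ_{γ,t}` is the diagonal automorphism
`diagonalAut G` of the model hypersurface.** [cite: Katz2009, §3] -/
theorem sigmaMFiber_comp_eq_diagonalAut (hγ : FixesMonomials ℂ n d M γ) (t : AlgPoints (baseM ℂ n d M) ℂ)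
    {G : MvPolynomial (Fin (n + 2)) ℂ} (e : fiberOver (familyM ℂ n d M) t ≅ SmoothHypersurface.hypersurface G)
    (he : e.hom ≫ SmoothHypersurface.hypersurfaceι G = fiberToProjectiveSpace ℂ n d M t)
    (ha : γ ∈ HodgeTheory.diagonalStabilizer G) :
    sigmaMFiber ℂ n d M γ hγ t ≫ e.hom = e.hom ≫ HodgeTheory.diagonalAut G ha :=
  sigmaMFiber_comp_eq ℂ n d M γ hγ t e he (HodgeTheory.diagonalAut G ha) (HodgeTheory.diagonalAut_comp_ι G ha)

end Complex

end Literature.AlgebraicGeometry.Motives.UniversalHypersurface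

end
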